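import Literature.Computation.Certificates.KeyedTableStreamSound

/-!
# Table contribution streams, III: the table part of the stream as a sum over all family ids

Companion of `KeyedTableStream` / `KeyedTableStreamSound` in the «K-STREAM» lane. Proved here:
window glue for the table part (`tsum_append`, `sum_tsum_windows`) and for the table side pass
(`TabSideOK ⇒ TabSideAll`); the id pass's guarantees (`idPass` ⇒ every non-skipped id of every
family points below `P` at a table entry recorded with that id); consecutive family offsets
(`TabCtx.contrib_eq`, ids tile `[0, NU)`); and the identification of the stream's table part with
the sum of all families' contributions (`tsum_eq_sum_fams`) by the position ↔ id bijection
(two-sided table checks, `Finset.sum_image` / `Finset.sum_subset`; skipped ids and foreign table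
entries contribute `0`). [cite: BlekhermanParriloThomas2012, §3.1.4 eq. (3.12), p. 64]

WHAT THIS FILE IS NOT: no positivity and no link to the client's polynomials (that is
`KeyedPositivstellensatz`).
-/

namespace Literature.Computation.Certificates

namespace SOS

namespace Keyed

open PSD

/-! ### The table part of the stream as a sum over the ids of the families -/

section Ids

variable {R : Type*} [Field R]

/-- `tsum` over concatenation. [cite: BlekhermanParriloThomas2012, §3.1.4 eq. (3.12), p. 64] -/
theorem tsum_append (x : ℕ → R) (b n : ℕ) (tab : ℕ → ℕ × Bool × ℕ) :
    ∀ A B : List Entry, tsum x b n tab (A ++ B) = tsum x b n tab A + tsum x b n tab B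
  | [], B => by simp [tsum]
  | en :: A, B => by rw [List.cons_append, tsum, tsum, tsum_append x b n tab A B, add_assoc]

/-- `tsum` as a sum over positions. [cite: BlekhermanParriloThomas2012, §3.1.4 eq. (3.12), p. 64] -/
theorem tsum_eq_sum_range (x : ℕ → R) (b n : ℕ) (tab : ℕ → ℕ × Bool × ℕ) :
    ∀ L : List Entry, tsum x b n tab L = ∑ π ∈ Finset.range L.length, tval x b n tab (L.getD π (Entry.tab 0))
  | [] => by simp [tsum]
  | en :: L => by
    rw [tsum, List.length_cons, Finset.sum_range_succ', tsum_eq_sum_range x b n tab L, add_comm]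
    simp

/-- `tsum` over all windows. [cite: BlekhermanParriloThomas2012, §3.1.4 eq. (3.12), p. 64] -/
theorem sum_tsum_windows (x : ℕ → R) (b n : ℕ) (c : GramCtx) (tab : ℕ → ℕ × Bool × ℕ) :
    ∀ W : List (List (ℕ × ℕ)), (W.map fun w => tsum x b n tab (entries c w)).sum =
      tsum x b n tab (entries c (windowsChunks W))
  | [] => by simp [windowsChunks, entries, tsum]
  | w :: W => by
    rw [List.map_cons, List.sum_cons, sum_tsum_windows x b n c tab W, windowsChunks, entries_append, tsum_append]

/-- The value of one table entry is the value of its contribution. [folklore] -/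
private theorem tval_tab (x : ℕ → R) (b n : ℕ) (tab : ℕ → ℕ × Bool × ℕ) (id : ℕ) :
    tval x b n tab (Entry.tab id) = cval x b n (tab id) := rfl

/-- **Table side conditions at all positions.** [cite: BlekhermanParriloThomas2012, §3.1.4 eq. (3.12), p. 64] -/
def TabSideAll (c : GramCtx) (d : SideCtx) (t : TabCtx) (e : TabSide) (EL : List Entry) : Prop :=
  ∀ π < EL.length, tabSideEntry c d t e π (EL.getD π (Entry.tab 0)) = true

/-- Window list of table side passes (one `decide +kernel` per window file).
[cite: BlekhermanParriloThomas2012, §3.1.4 eq. (3.12), p. 64] -/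
def TabSideOK (c : GramCtx) (d : SideCtx) (t : TabCtx) (e : TabSide) : ℕ → List (List (ℕ × ℕ)) → Prop
  | _, [] => True
  | π, w :: W => tabSidePass c d t e π w = true ∧ TabSideOK c d t e (π + (entries c w).length) W

/-- What the table side pass establishes at every position it walked. [folklore] -/
private theorem tabSideList_spec (c : GramCtx) (d : SideCtx) (t : TabCtx) (e : TabSide) :
    ∀ (π₀ : ℕ) (L : List Entry), tabSideList c d t e π₀ L = true →
      ∀ k < L.length, tabSideEntry c d t e (π₀ + k) (L.getD k (Entry.tab 0)) = true
  | π₀, [], _, k, hk => by simp at hk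
  | π₀, en :: L, h, k, hk => by
    simp only [tabSideList, Bool.and_eq_true] at h
    cases k with
    | zero => simpa using h.1
    | succ k =>
      have hk' : k < L.length := by simpa using hk
      have := tabSideList_spec c d t e (π₀ + 1) L h.2 k hk'
      simpa [Nat.add_assoc, Nat.add_comm 1 k] using this

/-- Shifted form used in the window induction. [folklore] -/
private theorem tabSideAll_shift (c : GramCtx) (d : SideCtx) (t : TabCtx) (e : TabSide) :
    ∀ (W : List (List (ℕ × ℕ))) (π₀ : ℕ), TabSideOK c d t e π₀ W →
      ∀ k < (entries c (windowsChunks W)).length,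
        tabSideEntry c d t e (π₀ + k) ((entries c (windowsChunks W)).getD k (Entry.tab 0)) = true
  | [], π₀, _, k, hk => by simp [windowsChunks, entries] at hk
  | w :: W, π₀, h, k, hk => by
    obtain ⟨h1, h2⟩ := h
    rw [windowsChunks, entries_append] at hk ⊢
    by_cases hlt : k < (entries c w).length
    · rw [List.getD_append _ _ _ _ hlt]
      exact tabSideList_spec c d t e π₀ _ h1 k hlt
    · rw [not_lt] at hlt
      obtain ⟨k', rfl⟩ := Nat.exists_eq_add_of_le hlt
      rw [List.length_append] at hk
      rw [List.getD_append_right _ _ _ _ (Nat.le_add_right _ _), Nat.add_sub_cancel_left, ← Nat.add_assoc]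
      exact tabSideAll_shift c d t e W (π₀ + (entries c w).length) h2 k' (by omega)

/-- **Windows ⇒ all positions** for the table side pass. [cite: BlekhermanParriloThomas2012, §3.1.4 eq. (3.12), p. 64] -/
theorem tabSideAll_of_tabSideOK (c : GramCtx) (d : SideCtx) (t : TabCtx) (e : TabSide)
    {W : List (List (ℕ × ℕ))} (h : TabSideOK c d t e 0 W) : TabSideAll c d t e (entries c (windowsChunks W)) :=
  fun π hπ => by simpa using tabSideAll_shift c d t e W 0 h π hπ

/-- A local id of a family is SKIPPED (carries no contribution) iff the family is an inequality
family and the id's pair is below the diagonal. [folklore] -/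
def Family.skip (F : Family) (l : ℕ) : Bool := F.ineq && decide (l / F.T.n % F.A.n < l / F.T.n / F.A.n)

/-- Skipped ids contribute `0`. [cite: BlekhermanParriloThomas2012, §3.1.4 eq. (3.12), p. 64] -/
theorem Family.cval_eq_zero_of_skip (x : ℕ → R) (b n : ℕ) (F : Family) {l : ℕ} (h : F.skip l = true) :
    cval x b n (F.contribLocal l) = 0 := by
  simp only [Family.skip, Bool.and_eq_true, decide_eq_true_eq] at h
  obtain ⟨hF, hlt⟩ := h
  simp [Family.contribLocal, hF, cval, if_neg (not_le.mpr hlt), sval]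

/-- What `idRange` establishes for the non-skipped ids of its range. [folklore] -/
private theorem idRange_spec (c : GramCtx) (d : SideCtx) (e : TabSide) (F : Family) (P : ℕ) :
    ∀ (k l₀ : ℕ), idRange c d e F P k l₀ = true → ∀ l, l₀ ≤ l → l < l₀ + k → F.skip l = false →
      e.tabPosAt (F.off + l) < P ∧ c.s ≤ d.iAt c.wi (e.tabPosAt (F.off + l)) ∧
        e.dAt (e.tabPosAt (F.off + l)) = F.off + l
  | 0, l₀, _, l, h1, h2, _ => by omega
  | k + 1, l₀, h, l, h1, h2, hs => by
    rw [idRange, Bool.and_eq_true] at h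
    obtain ⟨hhead, hrest⟩ := h
    by_cases hl : l = l₀
    · subst hl
      have hskip : (F.ineq && decide (l / F.T.n % F.A.n < l / F.T.n / F.A.n)) = false := hs
      rw [hskip] at hhead
      simpa [Bool.and_eq_true, decide_eq_true_eq, and_assoc] using hhead
    · exact idRange_spec c d e F P k (l₀ + 1) hrest l (by omega) (by omega) hs

/-- What `idFams` establishes. [folklore] -/
private theorem idFams_spec (c : GramCtx) (d : SideCtx) (e : TabSide) (P : ℕ) :
    ∀ Fs : List Family, idFams c d e P Fs = true → ∀ F ∈ Fs, ∀ l < F.size, F.skip l = false →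
      e.tabPosAt (F.off + l) < P ∧ c.s ≤ d.iAt c.wi (e.tabPosAt (F.off + l)) ∧
        e.dAt (e.tabPosAt (F.off + l)) = F.off + l
  | [], _, F, hF, _, _, _ => by simp at hF
  | F₀ :: Fs, h, F, hF, l, hl, hs => by
    rw [idFams, Bool.and_eq_true] at h
    rcases List.mem_cons.mp hF with rfl | hF'
    · exact idRange_spec c d e F P F.size 0 h.1 l (Nat.zero_le _) (by omega) hs
    · exact idFams_spec c d e P Fs h.2 F hF' l hl hs

/-- `findFam` on consecutive families: an id in the range of the `k`-th family (offsets scanned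
from `acc`) is found in exactly that family. [folklore] -/
private theorem findFam_of_go (t : TabCtx) :
    ∀ (Fs : List Family) (acc : ℕ), TabCtx.offsOK.go t acc Fs = true →
      ∀ F ∈ Fs, ∀ l < F.size, acc ≤ F.off ∧ F.off + F.size ≤ t.NU ∧ TabCtx.findFam Fs (F.off + l) = some F
  | [], acc, _, F, hF, _, _ => by simp at hF
  | F₀ :: Fs, acc, h, F, hF, l, hl => by
    simp only [TabCtx.offsOK.go, Bool.and_eq_true, beq_iff_eq] at h
    obtain ⟨hoff, hgo⟩ := h
    have hmono : ∀ (Gs : List Family) (a : ℕ), TabCtx.offsOK.go t a Gs = true → a ≤ t.NU := by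
      intro Gs
      induction Gs with
      | nil => intro a ha; simp [TabCtx.offsOK.go] at ha; omega
      | cons G Gs ih =>
        intro a ha
        simp only [TabCtx.offsOK.go, Bool.and_eq_true, beq_iff_eq] at ha
        have := ih _ ha.2; omega
    rcases List.mem_cons.mp hF with rfl | hF'
    · refine ⟨by omega, by have := hmono Fs _ hgo; omega, ?_⟩
      simp [TabCtx.findFam, hl]
    · obtain ⟨h1, h2, h3⟩ := findFam_of_go t Fs (acc + F₀.size) hgo F hF' l hl
      refine ⟨by omega, h2, ?_⟩
      rw [TabCtx.findFam, if_neg (by omega), h3]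

/-- **`contrib` agrees with the family's own contribution** on the family's id range.
[cite: BlekhermanParriloThomas2012, §3.1.4 eq. (3.12), p. 64] -/
theorem TabCtx.contrib_eq {t : TabCtx} (h : t.offsOK = true) {F : Family} (hF : F ∈ t.fams) {l : ℕ}
    (hl : l < F.size) : t.contrib (F.off + l) = F.contribLocal l := by
  obtain ⟨_, _, h3⟩ := findFam_of_go t t.fams 0 h F hF l hl
  simp [TabCtx.contrib, h3]

/-- Ids of consecutive families tile `[acc, NU)`: a sum over the families' ranges is the sum over
the global ids. [folklore] -/
private theorem sum_go {M : Type*} [AddCommMonoid M] (t : TabCtx) (f : ℕ → M) :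
    ∀ (Fs : List Family) (acc : ℕ), TabCtx.offsOK.go t acc Fs = true →
      (Fs.map fun F => ∑ l ∈ Finset.range F.size, f (F.off + l)).sum =
        ∑ g ∈ Finset.range (t.NU - acc), f (acc + g)
  | [], acc, h => by
    simp only [TabCtx.offsOK.go, beq_iff_eq] at h
    simp [h]
  | F :: Fs, acc, h => by
    simp only [TabCtx.offsOK.go, Bool.and_eq_true, beq_iff_eq] at h
    obtain ⟨hoff, hgo⟩ := h
    have hNU : acc + F.size ≤ t.NU := by
      have : ∀ (Gs : List Family) (a : ℕ), TabCtx.offsOK.go t a Gs = true → a ≤ t.NU := by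
        intro Gs; induction Gs with
        | nil => intro a ha; simp [TabCtx.offsOK.go] at ha; omega
        | cons G Gs ih =>
          intro a ha; simp only [TabCtx.offsOK.go, Bool.and_eq_true, beq_iff_eq] at ha
          have := ih _ ha.2; omega
      exact this Fs _ hgo
    rw [List.map_cons, List.sum_cons, sum_go t f Fs (acc + F.size) hgo, hoff,
      show t.NU - acc = F.size + (t.NU - (acc + F.size)) by omega, Finset.sum_range_add]
    congr 1
    refine Finset.sum_congr rfl fun g _ => ?_
    rw [add_assoc]

/-- **The table part of the stream is the sum of all families' contributions.** From: the Gram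
side conditions and the table side conditions at every position, the id pass, consecutive
offsets. [cite: BlekhermanParriloThomas2012, §3.1.4 eq. (3.12), p. 64] -/
theorem tsum_eq_sum_fams (x : ℕ → R) (b n : ℕ) {c : GramCtx} {d : SideCtx} {t : TabCtx} {e : TabSide}
    {EL : List Entry} (hside : SideAll c d EL) (htab : TabSideAll c d t e EL)
    (hid : idPass c d t e EL.length = true) :
    tsum x b n t.contrib EL = (t.fams.map fun F => ∑ l ∈ Finset.range F.size, cval x b n (F.contribLocal l)).sum := by
  classical
  rw [idPass, Bool.and_eq_true] at hid
  obtain ⟨hoffs, hfams⟩ := hid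
  set P := EL.length
  -- (1) families' sums as a sum over valid global ids
  have hvalid : (t.fams.map fun F => ∑ l ∈ Finset.range F.size, cval x b n (F.contribLocal l)).sum =
      (t.fams.map fun F => ∑ l ∈ Finset.range F.size,
        (if F.skip l then 0 else cval x b n (t.contrib (F.off + l)))).sum := by
    congr 1
    refine List.map_congr_left fun F hF => Finset.sum_congr rfl fun l hl => ?_
    rw [Finset.mem_range] at hl
    by_cases hs : F.skip l = true
    · rw [if_pos hs, Family.cval_eq_zero_of_skip x b n F hs]
    · rw [if_neg hs, TabCtx.contrib_eq hoffs hF hl]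
  -- the global valid-id indicator
  let gv : ℕ → Prop := fun g => ∃ F ∈ t.fams, ∃ l < F.size, F.skip l = false ∧ g = F.off + l
  let f : ℕ → R := fun g => if gv g then cval x b n (t.contrib g) else 0
  have hfam_f : ∀ F ∈ t.fams, ∀ l < F.size,
      (if F.skip l then 0 else cval x b n (t.contrib (F.off + l))) = f (F.off + l) := by
    intro F hF l hl
    by_cases hs : F.skip l = true
    · rw [if_pos hs]
      have : ¬ gv (F.off + l) := by
        rintro ⟨F', hF', l', hl', hs', heq⟩
        -- same global id ⇒ same family and local id
        obtain ⟨_, _, h3⟩ := findFam_of_go t t.fams 0 hoffs F hF l hl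
        obtain ⟨_, _, h3'⟩ := findFam_of_go t t.fams 0 hoffs F' hF' l' hl'
        rw [heq] at h3
        have hFF : F = F' := by simpa [h3] using h3'.symm.trans h3 |>.symm
        subst hFF
        have : l = l' := by omega
        subst this
        rw [hs'] at hs; exact Bool.false_ne_true hs
      simp [f, this]
    · rw [if_neg hs]
      have : gv (F.off + l) := ⟨F, hF, l, hl, Bool.eq_false_iff.mpr hs, rfl⟩
      simp [f, this]
  have hvalid2 : (t.fams.map fun F => ∑ l ∈ Finset.range F.size,
        (if F.skip l then 0 else cval x b n (t.contrib (F.off + l)))).sum =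
      ∑ g ∈ Finset.range t.NU, f g := by
    have := sum_go t f t.fams 0 hoffs
    simp only [Nat.sub_zero, zero_add] at this
    rw [← this]
    congr 1
    exact List.map_congr_left fun F hF => Finset.sum_congr rfl fun l hl => hfam_f F hF l (Finset.mem_range.mp hl)
  rw [hvalid, hvalid2, tsum_eq_sum_range]
  -- (2) positions ↔ valid ids
  let V : Finset ℕ := (Finset.range t.NU).filter fun g => gv g
  have hfV : ∑ g ∈ Finset.range t.NU, f g = ∑ g ∈ V, cval x b n (t.contrib g) := by
    rw [Finset.sum_filter]
  rw [hfV]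
  -- facts about a valid id
  have hval : ∀ g ∈ V, e.tabPosAt g < P ∧ c.s ≤ d.iAt c.wi (e.tabPosAt g) ∧ e.dAt (e.tabPosAt g) = g := by
    intro g hg
    rw [Finset.mem_filter] at hg
    obtain ⟨_, F, hF, l, hl, hs, rfl⟩ := hg
    exact idFams_spec c d e P t.fams hfams F hF l hl hs
  have hinj : Set.InjOn e.tabPosAt ↑V := by
    intro g hg g' hg' h
    have h1 := (hval g (by simpa using hg)).2.2
    have h2 := (hval g' (by simpa using hg')).2.2
    rw [← h1, ← h2]; exact congrArg _ h
  have himg : V.image e.tabPosAt ⊆ Finset.range P := by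
    intro π hπ
    obtain ⟨g, hg, rfl⟩ := Finset.mem_image.mp hπ
    exact Finset.mem_range.mpr (hval g hg).1
  have hzero : ∀ π ∈ Finset.range P, π ∉ V.image e.tabPosAt →
      tval x b n t.contrib (EL.getD π (Entry.tab 0)) = 0 := by
    intro π hπ hnot
    cases hE : EL.getD π (Entry.tab 0) with
    | gram i j sg mag => rfl
    | tab g =>
      rw [tval_tab]
      have hs := htab π (Finset.mem_range.mp hπ)
      rw [hE] at hs
      simp only [tabSideEntry, Bool.and_eq_true, decide_eq_true_eq, beq_iff_eq] at hs
      obtain ⟨⟨⟨hNU, hpos⟩, _⟩, _⟩ := hs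
      by_cases hg : gv g
      · exact absurd (Finset.mem_image.mpr ⟨g, Finset.mem_filter.mpr ⟨Finset.mem_range.mpr hNU, hg⟩, hpos⟩) hnot
      · -- not a valid id: no family (contrib 0) or a skipped id (magnitude 0)
        cases hff : TabCtx.findFam t.fams g with
        | none => simp [TabCtx.contrib, hff, cval, sval]
        | some F =>
          -- F ∈ fams with F.off ≤ g < F.off + size, found by the scan
          have hmemF : ∀ (Fs : List Family) (G : Family), TabCtx.findFam Fs g = some G →
              G ∈ Fs ∧ g < G.off + G.size := by
            intro Fs; induction Fs with
            | nil => intro G h; simp [TabCtx.findFam] at h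
            | cons F₁ Fs ih =>
              intro G h
              simp only [TabCtx.findFam] at h
              split at h
              · simp only [Option.some.injEq] at h; subst h; exact ⟨List.mem_cons_self, by assumption⟩
              · obtain ⟨h1, h2⟩ := ih G h; exact ⟨List.mem_cons_of_mem _ h1, h2⟩
          obtain ⟨hFmem, hglt⟩ := hmemF t.fams F hff
          -- is F.off ≤ g?  from the scan structure: findFam returns the first family whose bound exceeds g;
          -- we show g − F.off < size and contrib g = contribLocal (g − F.off)
          by_cases hge : F.off ≤ g
          · have hl : g - F.off < F.size := by omega
            have hcontrib : t.contrib g = F.contribLocal (g - F.off) := by simp [TabCtx.contrib, hff]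
            rw [hcontrib]
            by_cases hsk : F.skip (g - F.off) = true
            · exact Family.cval_eq_zero_of_skip x b n F hsk
            · exact absurd ⟨F, hFmem, g - F.off, hl, Bool.eq_false_iff.mpr hsk, by omega⟩ hg
          · -- g below F.off: then an EARLIER family contains g (offsets tile from 0), contradicting `findFam = some F`
            exfalso
            have hcover : ∀ (Fs : List Family) (acc : ℕ), TabCtx.offsOK.go t acc Fs = true → acc ≤ g →
                ∀ G, TabCtx.findFam Fs g = some G → G.off ≤ g := by
              intro Fs; induction Fs with
              | nil => intro acc _ _ G h; simp [TabCtx.findFam] at h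
              | cons F₁ Fs ih =>
                intro acc hgo hacc G h
                simp only [TabCtx.offsOK.go, Bool.and_eq_true, beq_iff_eq] at hgo
                simp only [TabCtx.findFam] at h
                split at h
                · simp only [Option.some.injEq] at h; subst h; omega
                · exact ih _ hgo.2 (by omega) G h
            exact hge (hcover t.fams 0 hoffs (Nat.zero_le _) F hff)
  rw [← Finset.sum_subset himg hzero, Finset.sum_image hinj]
  refine Finset.sum_congr rfl fun g hg => ?_
  obtain ⟨hP, hiat, hdat⟩ := hval g hg
  -- the entry at the id's position is `tab g`
  cases hE : EL.getD (e.tabPosAt g) (Entry.tab 0) with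
  | gram i j sg mag =>
    exfalso
    have hs := hside _ hP
    rw [hE] at hs
    simp only [sideEntry, Bool.and_eq_true, decide_eq_true_eq, beq_iff_eq] at hs
    obtain ⟨⟨⟨⟨⟨⟨_, hjs⟩, _⟩, hi⟩, _⟩, _⟩, _⟩ := hs
    omega
  | tab g' =>
    have hs := htab _ hP
    rw [hE] at hs
    simp only [tabSideEntry, Bool.and_eq_true, decide_eq_true_eq, beq_iff_eq] at hs
    obtain ⟨⟨⟨_, _⟩, hd⟩, _⟩ := hs
    rw [hdat] at hd
    subst hd
    rfl

end Ids

end Keyed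

end SOS

end Literature.Computation.Certificates

/-! ### Splitting the id pass by families (APPEND 2026-08-27; per-file budget insurance)

`idPass c d t e P = t.offsOK && idFams c d e P t.fams`; when one decide is too big the family list is
cut into consecutive pieces, `idFams` decided per piece, and reassembled with `idFams_append`. -/

namespace Literature.Computation.Certificates.SOS.Keyed

/-- `idFams` over a concatenation of family lists is the conjunction.
[cite: BlekhermanParriloThomas2012, §3.1.4 eq. (3.12), p. 64] -/
theorem idFams_append (c : GramCtx) (d : SideCtx) (e : TabSide) (P : ℕ) :
    ∀ (Fs₁ Fs₂ : List Family), idFams c d e P (Fs₁ ++ Fs₂) = (idFams c d e P Fs₁ && idFams c d e P Fs₂)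
  | [], Fs₂ => by simp [idFams]
  | F :: Fs₁, Fs₂ => by rw [List.cons_append, idFams, idFams, idFams_append c d e P Fs₁ Fs₂, Bool.and_assoc]

/-- Usage template: `idPass` from `offsOK` and two family-range facts. [folklore] -/
example (c : GramCtx) (d : SideCtx) (e : TabSide) (P : ℕ) (t : TabCtx) (Fs₁ Fs₂ : List Family)
    (ht : t.fams = Fs₁ ++ Fs₂) (h₀ : t.offsOK = true) (h₁ : idFams c d e P Fs₁ = true)
    (h₂ : idFams c d e P Fs₂ = true) : idPass c d t e P = true := by
  rw [idPass, h₀, ht, idFams_append, h₁, h₂]; rfl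

end Literature.Computation.Certificates.SOS.Keyed
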